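import Summits.QuantumFields.YangMills.Theorems.BalabanUVNodesN15PairedFamilyGuard
import Summits.QuantumFields.YangMills.Theorems.BalabanUVNodesRateCarriersOfRecord13CoPHCmap

/-!
# Route «BalabanUVNodes», cluster K4 «SpineRates» — node N15 = NE2: THE KEYED NON-DEGENERACY GUARD `KeyedLive` RE-ISSUED CENTRE-MAP-GENERIC («Cmap») WITH THE
# RE-CENTRED («Ax») INSTANCE — §1b ∕ §2 (keyed doors) ∕ §4 (reading witness) of `Thm/BalabanUVNodesN15PairedFamilyGuard` (dag-n15-w2) over the provisos
# `θ.Provisos₁₃CoPHChi F N (Χ F θ)`, the guard of record `ZhUnity ∧ SlotsNondegenerate₁₃Chi … (Χ F θ)` and the reading `RateReading₁₃CoPHCmap N Χ` (T1) — op 5c K3ᴬ supply row R11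

Cell `pub-ymgap`, seat `pub-ymgap-dag-n15-a` g38 (dag-lead WORDS 591 HANDS-4 (b) row R11; plan g99 `OP5C-SUPPLY-CENSUS-K3v8.md` §2 row 11).  `--supports stmt-QuantumFields-27247`
(K3ᴬ `SpineGivenEndpointR13SepCoPHVAx`) AS A HELPER — count-neutral.  Definition lane by content: ONE `def … : Prop` (the keyed guard over a centre map) + ONE `abbrev` (its Ax
instance); every theorem is kernel bookkeeping over tree declarations BY NAME; the parent is untouched (NEW basename; body-freeze; the [Ax-3c]∕[Ax-3d] pattern).

THE POINT.  The parent's keyed guard `KeyedLive rr` binds the tuple-level reading `rr` over the CHOICE-centred provisos `θ.Provisos₁₃CoPH F N` and keys it by the guard of record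
`θ.ZhUnity F N ∧ θ.SlotsNondegenerate₁₃ F N`; the K3ᴬ skeleton (v8) reads `θ.Provisos₁₃CoPHAx` ∕ `θ.SlotsNondegenerate₁₃Ax` (`Node00/Record13CoPHChi` :507, `Node00/Record13Chi`
:615) and the bundle of record `rateCarriersOfRecord₁₃CoPHCmap` of a reading `RateReading₁₃CoPHAx N` (T1 `Thm/BalabanUVNodesRateCarriersOfRecord13CoPHCmap`, dag-n16-e g30).
This file re-issues `KeyedLive` over a centre map `Χ` — `KeyedLiveCmap Χ rr` — with the Ax instance `KeyedLiveAx`, the receipt at `Χ := chiβOfRecord₁₃` (the parent's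
`KeyedLive`, through `provisos₁₃CoPHChi_chiβ_iff` — an `Iff`, field-wise), and the parent's keyed bookkeeping over it: the `Iff.rfl` face at the bundle of record, the (J1)∕(J2)
junk doors, the located vacuity, and the positive control (SOME centre-map-generic reading passes the guard at the bundle of record AND carries `N15At` there).  `Live`, `N15At`,
the carrier-level doors and the knit witness `live_and_n15At_knitCarriers` are χ-FREE and USED BY NAME; `ZhUnity` ∕ `Admissible` are χ-free (`Record13CoPH` :327 reads `θ.Zh` only).

WHAT THIS MODULE DECLARES ∕ PROVES.
* §1 `KeyedLiveCmap Χ rr` (def) · `KeyedLiveAx rr` (abbrev) · `keyedLiveCmap_iff` (`Iff.rfl`) · RECEIPT `keyedLiveCmap_chiβ_iff` (at `Χ := chiβOfRecord₁₃` it IS the parent's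
  `KeyedLive` of the reading transported along `provisos₁₃CoPHChi_chiβ_iff`) · `keyedLiveCmap_rateCarriersOfRecord₁₃CoPHCmap_iff` (at the bundle of record it reads
  `Live (ne2OfRecord₁₁ ((𝔯.lit F θ hP g₀ os).ne2 (ksel …)))`, `Iff.rfl`) · `populated_of_keyedLiveCmap_rateCarriersOfRecord₁₃CoPHCmap`.
* §2 KEYED JUNK DOORS over the centre map: (J1) `not_keyedLiveCmap_of_isEmpty`, (J2) `not_keyedLiveCmap_of_gf_M_lt` (under the existence of ONE guarded admissible tuple of the
  Χ-world), located vacuity `keyedLiveCmap_of_no_tuple`.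
* §3 POSITIVE CONTROL ★ `exists_readingCmap_keyedLive_n15At` (any `Χ`; the knit-objects reading — R3's positive control at the N15 slot, centre-map-generic) and its Ax instance
  `exists_readingAx_keyedLive_n15At`.

A6 (№189) — SATISFIABILITY.  `KeyedLiveCmap Χ (rateCarriersOfRecord₁₃CoPHCmap 𝔯 … (ksel …))` is INHABITED for every `Χ` and every selector by §3's reading (hypothesis-free).

HONEST FRAMING.  Helper lane, count-neutral kernel bookkeeping; a GUARD EXCLUDES CARRIER JUNK, it does not tie `ne2`'s kernels to Bałaban's propagators and asserts no
estimate; nothing of Bałaban's is asserted or instantiated; NE2⁺ is NOT PRINTED for d = 4 and NOT PROVED; N15's record (DISCHARGED AS CONSUMED, p687738) untouched; K3ᴬ OPEN,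
not claimed; counts UNMOVED (typed 28∕28 · discharged 8∕27, A 8∕28); the Yang–Mills mass gap (Clay) is NOT proved by any of this — R4 closes the conditional finite-𝕋⁴ rung
`BalabanLadder.UV` only; nothing continuum ∕ ℝ⁴ ∕ OS.  No `sorry`, no `instance`, no `notation`, no `structure`; restate-immune (no Theses import).
-/

set_option autoImplicit false

noncomputable section

namespace Summit.QuantumFields.YangMills.BalabanUVNodes.N15.PairedFamilyGuard

open Literature.MathematicalPhysics.QuantumFieldTheory.Balaban1983to89
open Literature.MathematicalPhysics.QuantumFieldTheory.Balaban1983to89.T4Continuum (T4Family ULoop)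
open Literature.MathematicalPhysics.QuantumFieldTheory.Balaban1983to89.NE2NodeTorus (KnitIndex knitInstance knitOp166 knitSite163 covOpKernels inAll rhoDist)
open Node00 (Stage13Params Stage13HParams ChiSlot chiβOfRecord₁₃ chiβOfRecord₁₃Ax NE2Objects₁₁ RateObjects₁₁ nonempty_rateObjects₁₁ provisos₁₃CoPHChi_chiβ_iff)
open YMDAG.UVSplit (NE1pCarriers NE2Carriers RateCarriers N15At ne2OfRecord₁₁ RateReading₁₃CoPHCmap RateReading₁₃CoPHAx rateCarriersOfRecord₁₃CoPHCmap)

/-! ## §1 The keyed guard over a centre map, its Ax instance, its receipt and faces -/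

section KeyedCmap

variable {N : ℕ} [NeZero N] (Χ : (F : T4Family) → Stage13Params F N → ChiSlot F N)

/-- **THE KEYED GUARD, CENTRE-MAP-GENERIC** for a tuple-level rate reading `rr` over the provisos `θ.Provisos₁₃CoPHChi F N (Χ F θ)` (the K3ᴬ skeleton's `rrOfRecord 𝔯 ksel`
at `Χ := chiβOfRecord₁₃Ax`; binder shape = its `KeyedRatesHolderD4`): at every admissible Stage-13 tuple with core provisos at the β-slot `Χ F θ`, under the guard of record
`ZhUnity ∧ SlotsNondegenerate₁₃Chi … (Χ F θ)`, for every `(g₀, os)`, the reading's N15 carriers are live.  The parent's `KeyedLive` is the instance `Χ := chiβOfRecord₁₃`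
(`keyedLiveCmap_chiβ_iff`). [folklore] -/
@[folklore]
def KeyedLiveCmap (rr : (F : T4Family) → (θ : Stage13HParams F N) → θ.Provisos₁₃CoPHChi F N (Χ F θ.toStage13Params) → (ℕ → ℝ) → List (ULoop F) → RateCarriers N) :
    Prop :=
  ∀ (F : T4Family) (θ : Stage13HParams F N) (hP : θ.Provisos₁₃CoPHChi F N (Χ F θ.toStage13Params)),
    (θ.ZhUnity F N ∧ θ.SlotsNondegenerate₁₃Chi F N (Χ F θ.toStage13Params)) → θ.Admissible F N →
      ∀ (g₀ : ℕ → ℝ) (os : List (ULoop F)), Live (rr F θ hP g₀ os).ne2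

/-- Unfolding (`Iff.rfl`). [bookkeeping] -/
theorem keyedLiveCmap_iff
    (rr : (F : T4Family) → (θ : Stage13HParams F N) → θ.Provisos₁₃CoPHChi F N (Χ F θ.toStage13Params) → (ℕ → ℝ) → List (ULoop F) → RateCarriers N) :
    KeyedLiveCmap Χ rr ↔
      ∀ (F : T4Family) (θ : Stage13HParams F N) (hP : θ.Provisos₁₃CoPHChi F N (Χ F θ.toStage13Params)),
        (θ.ZhUnity F N ∧ θ.SlotsNondegenerate₁₃Chi F N (Χ F θ.toStage13Params)) → θ.Admissible F N →
          ∀ (g₀ : ℕ → ℝ) (os : List (ULoop F)), Live (rr F θ hP g₀ os).ne2 :=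
  Iff.rfl

/-- **RECEIPT: AT THE RECORD's OWN β-SLOT `Χ := chiβOfRecord₁₃` THE CENTRE-MAP-GENERIC GUARD IS THE PARENT's `KeyedLive`** — for a reading `rr` over the record's provisos
`θ.Provisos₁₃CoPH F N`, read at the χ-generic provisos through `provisos₁₃CoPHChi_chiβ_iff` (field-wise `Iff`; `SlotsNondegenerate₁₃Chi θ (chiβOfRecord₁₃ θ)` IS
`SlotsNondegenerate₁₃ θ` definitionally). [bookkeeping] -/
theorem keyedLiveCmap_chiβ_iff (rr : (F : T4Family) → (θ : Stage13HParams F N) → θ.Provisos₁₃CoPH F N → (ℕ → ℝ) → List (ULoop F) → RateCarriers N) :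
    KeyedLiveCmap (fun F θ => chiβOfRecord₁₃ F N θ) (fun F θ hP g₀ os => rr F θ ((provisos₁₃CoPHChi_chiβ_iff θ).1 hP) g₀ os) ↔ KeyedLive rr := by
  constructor
  · intro h F θ hP hU hθ g₀ os
    exact h F θ ((provisos₁₃CoPHChi_chiβ_iff θ).2 hP) hU hθ g₀ os
  · intro h F θ hP hU hθ g₀ os
    exact h F θ ((provisos₁₃CoPHChi_chiβ_iff θ).1 hP) hU hθ g₀ os

/-- **AT THE BUNDLE OF RECORD** (T1's `rateCarriersOfRecord₁₃CoPHCmap`) the centre-map-generic keyed guard reads on the reading's level-selected NE2 OBJECTS: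
`Live (ne2OfRecord₁₁ ((𝔯.lit F θ hP g₀ os).ne2 (ksel …)))` (`Iff.rfl`; the bundle's second component). [bookkeeping] -/
theorem keyedLiveCmap_rateCarriersOfRecord₁₃CoPHCmap_iff (𝔯 : RateReading₁₃CoPHCmap N Χ)
    (ksel : (F : T4Family) → (θ : Stage13HParams F N) → θ.Provisos₁₃CoPHChi F N (Χ F θ.toStage13Params) → (ℕ → ℝ) → List (ULoop F) → ℕ) :
    KeyedLiveCmap Χ (fun F θ hP g₀ os => rateCarriersOfRecord₁₃CoPHCmap 𝔯 F θ hP g₀ os (ksel F θ hP g₀ os)) ↔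
      ∀ (F : T4Family) (θ : Stage13HParams F N) (hP : θ.Provisos₁₃CoPHChi F N (Χ F θ.toStage13Params)),
        (θ.ZhUnity F N ∧ θ.SlotsNondegenerate₁₃Chi F N (Χ F θ.toStage13Params)) → θ.Admissible F N →
          ∀ (g₀ : ℕ → ℝ) (os : List (ULoop F)), Live (ne2OfRecord₁₁ ((𝔯.lit F θ hP g₀ os).ne2 (ksel F θ hP g₀ os))) :=
  Iff.rfl

/-- … hence a keyed-live centre-map-generic reading of record is `Populated` at every selected level (RR-1's display, keyed). [bookkeeping] -/
theorem populated_of_keyedLiveCmap_rateCarriersOfRecord₁₃CoPHCmap (𝔯 : RateReading₁₃CoPHCmap N Χ)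
    (ksel : (F : T4Family) → (θ : Stage13HParams F N) → θ.Provisos₁₃CoPHChi F N (Χ F θ.toStage13Params) → (ℕ → ℝ) → List (ULoop F) → ℕ)
    (h : KeyedLiveCmap Χ (fun F θ hP g₀ os => rateCarriersOfRecord₁₃CoPHCmap 𝔯 F θ hP g₀ os (ksel F θ hP g₀ os)))
    (F : T4Family) (θ : Stage13HParams F N) (hP : θ.Provisos₁₃CoPHChi F N (Χ F θ.toStage13Params))
    (hU : θ.ZhUnity F N ∧ θ.SlotsNondegenerate₁₃Chi F N (Χ F θ.toStage13Params)) (hθ : θ.Admissible F N) (g₀ : ℕ → ℝ) (os : List (ULoop F)) :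
    ((𝔯.lit F θ hP g₀ os).ne2 (ksel F θ hP g₀ os)).Populated :=
  Live.populated_of_ne2OfRecord₁₁ (h F θ hP hU hθ g₀ os)

/-- **THE KEYED GUARD AT THE RE-CENTRED RECORD** (`Χ := chiβOfRecord₁₃Ax`; provisos `θ.Provisos₁₃CoPHAx F N`, guard `θ.SlotsNondegenerate₁₃Ax F N` — both `abbrev`s of the
χ-generic ones): the K3ᴬ v8 skeleton's `KeyedLive (rrOfRecord 𝔯 ksel)` conjunct of `GuardedReading`, BY NAME. [folklore] -/
@[folklore]
abbrev KeyedLiveAx (rr : (F : T4Family) → (θ : Stage13HParams F N) → θ.Provisos₁₃CoPHAx F N → (ℕ → ℝ) → List (ULoop F) → RateCarriers N) : Prop :=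
  KeyedLiveCmap (fun F => chiβOfRecord₁₃Ax F N) rr

/-- Unfolding of the Ax instance (`Iff.rfl`; the guard displayed as `θ.SlotsNondegenerate₁₃Ax F N`). [bookkeeping] -/
theorem keyedLiveAx_iff (rr : (F : T4Family) → (θ : Stage13HParams F N) → θ.Provisos₁₃CoPHAx F N → (ℕ → ℝ) → List (ULoop F) → RateCarriers N) :
    KeyedLiveAx rr ↔
      ∀ (F : T4Family) (θ : Stage13HParams F N) (hP : θ.Provisos₁₃CoPHAx F N), (θ.ZhUnity F N ∧ θ.SlotsNondegenerate₁₃Ax F N) → θ.Admissible F N →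
        ∀ (g₀ : ℕ → ℝ) (os : List (ULoop F)), Live (rr F θ hP g₀ os).ne2 :=
  Iff.rfl

end KeyedCmap

/-! ## §2 The keyed junk doors over the centre map: (J1) empty family, (J2) bounded size parameter; located vacuity -/

section KeyedDoorsCmap

variable {N : ℕ} [NeZero N] {Χ : (F : T4Family) → Stage13Params F N → ChiSlot F N}
  (rr : (F : T4Family) → (θ : Stage13HParams F N) → θ.Provisos₁₃CoPHChi F N (Χ F θ.toStage13Params) → (ℕ → ℝ) → List (ULoop F) → RateCarriers N)

/-- **(J1) KEYED, centre-map-generic — R3's negative control**: as soon as ONE guarded admissible Stage-13 tuple of the Χ-world exists, a reading whose paired family is EMPTY at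
every tuple FAILS `KeyedLiveCmap Χ`. [bookkeeping] -/
theorem not_keyedLiveCmap_of_isEmpty
    (hex : ∃ (F : T4Family) (θ : Stage13HParams F N) (_ : θ.Provisos₁₃CoPHChi F N (Χ F θ.toStage13Params)),
      (θ.ZhUnity F N ∧ θ.SlotsNondegenerate₁₃Chi F N (Χ F θ.toStage13Params)) ∧ θ.Admissible F N)
    (h : ∀ (F : T4Family) (θ : Stage13HParams F N) (hP : θ.Provisos₁₃CoPHChi F N (Χ F θ.toStage13Params)) (g₀ : ℕ → ℝ) (os : List (ULoop F)),
      IsEmpty (rr F θ hP g₀ os).ne2.I) :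
    ¬ KeyedLiveCmap Χ rr := fun hk => by
  obtain ⟨F, θ, hP, hU, hθ⟩ := hex
  haveI := h F θ hP (fun _ => 0) []
  exact (n15At_and_not_live_of_isEmpty (rr F θ hP (fun _ => 0) []).ne2).2 (hk F θ hP hU hθ (fun _ => 0) [])

/-- **(J2) KEYED, centre-map-generic**: under the same existence, a reading whose paired families have UNIFORMLY BOUNDED size parameter `gf.M` FAILS `KeyedLiveCmap Χ` — although
its operator and site layers hold everywhere for arbitrary kernels (`ne2PlusOperator_of_gf_M_lt` ∕ `ne2PlusSite_of_gf_M_lt`). [bookkeeping] -/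
theorem not_keyedLiveCmap_of_gf_M_lt
    (hex : ∃ (F : T4Family) (θ : Stage13HParams F N) (_ : θ.Provisos₁₃CoPHChi F N (Χ F θ.toStage13Params)),
      (θ.ZhUnity F N ∧ θ.SlotsNondegenerate₁₃Chi F N (Χ F θ.toStage13Params)) ∧ θ.Admissible F N)
    {M₅ : ℝ} (h : ∀ (F : T4Family) (θ : Stage13HParams F N) (hP : θ.Provisos₁₃CoPHChi F N (Χ F θ.toStage13Params)) (g₀ : ℕ → ℝ) (os : List (ULoop F))
      (i : (rr F θ hP g₀ os).ne2.I), ((rr F θ hP g₀ os).ne2.pi i).gf.M < M₅) :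
    ¬ KeyedLiveCmap Χ rr := fun hk => by
  obtain ⟨F, θ, hP, hU, hθ⟩ := hex
  exact not_live_of_gf_M_lt _ (h F θ hP (fun _ => 0) []) (hk F θ hP hU hθ (fun _ => 0) [])

/-- **HONESTY — located vacuity, centre-map-generic**: if NO guarded admissible Stage-13 tuple of the Χ-world exists (the negation of K0's content at `N` in that world), EVERY
reading is keyed-live with no witness at all; the keyed guard is worth exactly K0. [bookkeeping] -/
theorem keyedLiveCmap_of_no_tuple
    (hno : ∀ (F : T4Family) (θ : Stage13HParams F N), θ.Provisos₁₃CoPHChi F N (Χ F θ.toStage13Params) →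
      (θ.ZhUnity F N ∧ θ.SlotsNondegenerate₁₃Chi F N (Χ F θ.toStage13Params)) → ¬ θ.Admissible F N) :
    KeyedLiveCmap Χ rr := fun F θ hP hU hθ _ _ => absurd hθ (hno F θ hP hU)

end KeyedDoorsCmap

/-! ## §3 Positive control: SOME centre-map-generic Stage-13 reading passes the keyed guard at the bundle of record and carries `N15At` there -/

section WitnessCmap

variable {N : ℕ} [NeZero N] (Χ : (F : T4Family) → Stage13Params F N → ChiSlot F N)

/-- ★ **SOME CENTRE-MAP-GENERIC STAGE-13 READING PASSES `KeyedLiveCmap Χ` AT THE BUNDLE OF RECORD AND CARRIES `N15At` THERE, FOR EVERY RUN-LENGTH SELECTOR** (any `Χ`; R3's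
positive control at the N15 slot of the K3ᴬ skeleton): the reading whose NE2 objects at every tuple and run length are the -a lane's knit objects on `KnitIndex 3 2` (the other
rate objects = RR-1's sanity inhabitant, the dressed tower empty — «don't-care» fillers of NO content, displayed in the proof; the parent's witness `live_and_n15At_knitCarriers` BY
NAME).  MODEL level: NOT Bałaban's multiscale `G(U)`. [bookkeeping] -/
theorem exists_readingCmap_keyedLive_n15At {μ ν : Fin 4} (hμν : μ ≠ ν) (a b μ' lam α β : Fin 4) (c35 p : ℝ) :
    ∃ 𝔯 : RateReading₁₃CoPHCmap N Χ,
      ∀ ksel : (F : T4Family) → (θ : Stage13HParams F N) → θ.Provisos₁₃CoPHChi F N (Χ F θ.toStage13Params) → (ℕ → ℝ) → List (ULoop F) → ℕ,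
        KeyedLiveCmap Χ (fun F θ hP g₀ os => rateCarriersOfRecord₁₃CoPHCmap 𝔯 F θ hP g₀ os (ksel F θ hP g₀ os)) ∧
          ∀ (F : T4Family) (θ : Stage13HParams F N) (hP : θ.Provisos₁₃CoPHChi F N (Χ F θ.toStage13Params)) (g₀ : ℕ → ℝ) (os : List (ULoop F)),
            N15At (rateCarriersOfRecord₁₃CoPHCmap 𝔯 F θ hP g₀ os (ksel F θ hP g₀ os)).ne2 := by
  obtain ⟨r₀⟩ := nonempty_rateObjects₁₁ (N := N)
  let o : NE2Objects₁₁ := ⟨KnitIndex 3 2, c35, p, knitInstance 3 2, knitOp166 2 μ ν a b, knitSite163 2 μ' lam, covOpKernels 2 α β, inAll 2, rhoDist 2⟩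
  let 𝔯 : RateReading₁₃CoPHCmap N Χ :=
    ⟨fun _ _ _ _ _ => ⟨r₀.u3, r₀.ne3, fun _ => o⟩, fun _ _ _ _ _ => (⟨Empty, ⟨fun q => q.elim, fun q => q.elim, fun q => q.elim⟩, 0⟩ : NE1pCarriers)⟩
  have key := live_and_n15At_knitCarriers 2 le_rfl hμν a b μ' lam α β c35 p
  exact ⟨𝔯, fun ksel => ⟨fun F θ hP _ _ g₀ os => key.1, fun F θ hP g₀ os => key.2⟩⟩

/-- ★ The same AT THE RE-CENTRED RECORD: some `RateReading₁₃CoPHAx N` passes `KeyedLiveAx` at the bundle of record and carries `N15At` there, for every selector (§3 at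
`Χ := chiβOfRecord₁₃Ax`). [bookkeeping] -/
theorem exists_readingAx_keyedLive_n15At {μ ν : Fin 4} (hμν : μ ≠ ν) (a b μ' lam α β : Fin 4) (c35 p : ℝ) :
    ∃ 𝔯 : RateReading₁₃CoPHAx N,
      ∀ ksel : (F : T4Family) → (θ : Stage13HParams F N) → θ.Provisos₁₃CoPHAx F N → (ℕ → ℝ) → List (ULoop F) → ℕ,
        KeyedLiveAx (fun F θ hP g₀ os => rateCarriersOfRecord₁₃CoPHCmap 𝔯 F θ hP g₀ os (ksel F θ hP g₀ os)) ∧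
          ∀ (F : T4Family) (θ : Stage13HParams F N) (hP : θ.Provisos₁₃CoPHAx F N) (g₀ : ℕ → ℝ) (os : List (ULoop F)),
            N15At (rateCarriersOfRecord₁₃CoPHCmap 𝔯 F θ hP g₀ os (ksel F θ hP g₀ os)).ne2 :=
  exists_readingCmap_keyedLive_n15At (fun F => chiβOfRecord₁₃Ax F N) hμν a b μ' lam α β c35 p

end WitnessCmap

end Summit.QuantumFields.YangMills.BalabanUVNodes.N15.PairedFamilyGuard

end
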